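import Literature.Computability.Complexity.OccurrenceObstructionsIPComputations
import Literature.Computability.Complexity.OccurrenceObstructionsIPAssembly
import HarnessLib

/-!
# Ikenmeyer–Panova 2017, Thm. 1.4 (Main Theorem): the unconditional discharge

Sibling proofs file (D-0014) of `Literature/Computability/Complexity/OccurrenceObstructionsIP.lean`.
One theorem; no definition, no statement of the tree is changed and no named fact is introduced.

`ikenmeyerPanova2017_thm_1_4` is IP's Main Theorem, verbatim for IP's own padded permanent and for
ALL permanent sizes (in the tree's letters: permanent `n ≥ 1`, determinant `m > 3n⁴`, `λ ⊢ md` with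
at most `m²` parts whose weight occurs in `ℂ[\overline{GL_{m²} · X₀₀^{m-n} per_n}]`; conclusion
`g(λ, m × d, m × d) > 0`). The assembly
`ikenmeyerPanova2017_thm_1_4_of_thm_4_6_all : ikenmeyerPanova2017_thm_4_6 → ikenmeyerPanova2017_thm_1_4`
(`OccurrenceObstructionsIPAssembly.lean`) follows the printed proof (§1.1, held p. 5: Kadish–Landsberg
`|λ̄| ≤ md`, `ℓ(λ) ≤ m²`; the degree bound Cor. 1.6 from Prop. 2.8, discharged as
`ikenmeyerPanova2017_prop_2_8_holds`; Thm. 1.7(a) for `λ̄ ∈ 𝔛`, discharged as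
`ikenmeyerPanova2017_thm_1_7a_holds`; Thm. 1.7(b) = Thm. 4.6 + the transposition property for
`λ̄ ∉ 𝔛`) for `n ≥ 3` — the range in which the printed argument applies Thm. 1.7(b), whose parameter
must be `≥ 3` — and closes the remaining sizes `n ≤ 2` (indeed all `n ≤ 18`, where `2ⁿ - 1 ≤ 3n⁴ < m`)
through Grenet's determinantal representation of `per_n` of size `2ⁿ - 1`, under which the padded
permanent lies in the determinant orbit closure and every occurring `λ` has `g(λ, m × d, m × d) > 0`
by the Peter–Weyl/Kronecker description of `ℂ[GL_{m²} · det_m]`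
(`ikenmeyerPanova2017_thm_1_4_of_prop_2_8_of_thm_4_6_all`). The one hypothesis left there, the named
fact `ikenmeyerPanova2017_thm_4_6` (IP Thm. 4.6, the main Kronecker positivity theorem; held:
Thm. 23), is now discharged in the tree: `ikenmeyerPanova2017_thm_4_6_holds`
(`OccurrenceObstructionsIPComputations.lean`: the reduction of Thm. 4.6 to the Bessenrodt–Behns square
positivity, proved via the Frobenius character formula, and to finitely many Kronecker coefficients
of `𝔖_n`, `n ≤ 24`, certified in the kernel by a verified Murnaghan–Nakayama evaluator). This file
records the resulting unconditional theorem

* `ikenmeyerPanova2017_thm_1_4_holds : ikenmeyerPanova2017_thm_1_4`.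

## References

* C. Ikenmeyer, G. Panova, *Rectangular Kronecker coefficients and plethysms in geometric
  complexity theory*, Adv. Math. 319 (2017) 40–66 = arXiv:1512.03798: Thm. 1.4 (Main Theorem;
  held arXiv text: Thm. 4) and its proof, §1.1 (held p. 5). [key `IkenmeyerPanova2017`]

## Mathlib and tree

Tree only: `ikenmeyerPanova2017_thm_1_4_of_thm_4_6_all` (`OccurrenceObstructionsIPAssembly.lean`),
`ikenmeyerPanova2017_thm_4_6_holds` (`OccurrenceObstructionsIPComputations.lean`).
-/

namespace Literature.Computability.Complexity

/-- **Discharge of the named fact `ikenmeyerPanova2017_thm_1_4` (Ikenmeyer–Panova, Adv. Math. 319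
(2017), Thm. 1.4 = Main Theorem; held arXiv text: Thm. 4)**: "Let `n > 3m⁴`, `λ ⊢ nd`. If
`g(λ, n × d, n × d) = 0`, then `q^m_λ(d[n]) = 0`" — in the tree's letters and contrapositive form:
for a permanent size `0 < n`, a determinant size `m` with `3n⁴ < m`, and `λ ⊢ md` with at most `m²`
parts whose weight occurs in the coordinate ring of the orbit closure of IP's padded permanent
`X₀₀^{m-n} per_n`, one has `0 < g(λ, m × d, m × d)`. Unconditional: the assembly
`ikenmeyerPanova2017_thm_1_4_of_thm_4_6_all` (the printed proof for `n ≥ 3`, Grenet's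
representation for `n ≤ 18`) applied to the discharged main positivity theorem
`ikenmeyerPanova2017_thm_4_6_holds`.
[cite: IkenmeyerPanova2017, Thm. 1.4 (Main Theorem; held: Thm. 4) and §1.1 (its proof, held p. 5)] -/
theorem ikenmeyerPanova2017_thm_1_4_holds : ikenmeyerPanova2017_thm_1_4 :=
  ikenmeyerPanova2017_thm_1_4_of_thm_4_6_all ikenmeyerPanova2017_thm_4_6_holds

end Literature.Computability.Complexity
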